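import Literature.AlgebraicGeometry.ShimuraVarieties.UnitaryShimuraCurveEmbeddingDescent
import Literature.AlgebraicGeometry.ShimuraVarieties.UnitaryShimuraCurveEmbeddingWitnessFinite
import Literature.AlgebraicGeometry.ShimuraVarieties.HermitianNegConeOrbitDensity
import Literature.AlgebraicGeometry.Motives.ComplexPointsGaloisUnderlying
import Literature.AlgebraicGeometry.Motives.ComplexPointsZariskiDense
import Literature.AlgebraicGeometry.Motives.ComplexAutGaloisDescentIdealSheaf
import HarnessLib

/-!
# The EMBEDDED unitary Shimura curve in the canonical model of the compact unitary Shimura surface: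
# `Aut(ℂ/τL)`-stability of its Zariski closure and descent of that closure to `L`

Topic `AlgebraicGeometry/ShimuraVarieties`, namespace `…ShimuraVarieties.UnitaryCanonicalModel`.  THEOREMS ONLY (no definition, no
named fact, no instance, no `sorry`).  Cell `hodgecm-mathlib`, road (ii) «embedded-curve descent» of the census «GS-3 ⇐ #62»
(A-p10 g7) toward the GENERIC row GS-3 ★ `UnitaryCanonicalModel.exists_recordSystemGS`; leaves R2-3′ (image stability) and R2-4
(closure descent, one level) as cut in `A-provers/A-p04/CENSUS-R2-3-R2-4.A-p04g11.md`.  Books 0: nothing here is a proof of GS-3.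

DATA.  A rank-3 canonical-model record system ★ `RecordSystem L H τ T hT K₀'` (the compact unitary Shimura SURFACE `Sh(U(H), 𝔹²)`,
models `M_K` over the CM field `L` along `τ`), a frame `ᵗ(cB)·(a·H)·B = J⋆ ⊕ J⊥` with `τ a` a positive real (★ `φGS = R_B ∘ (· ⊕ 1)`),
ANY subgroup `K⋆ ≤ U(J⋆)(𝔸_{L⁺,f})` and a small level `K ≤ K₀'` with `φGS(K⋆) ≤ K`.  NO model of the curve is assumed (no
`RecordSystemGS`): the curve enters only through its complex Shimura SET ★ `ShimuraSetGS L J⋆ τ K⋆` and the sub-ball inclusion on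
complex points ★ `ShimuraSetGS.embPoints : Sh_{K⋆}(U(J⋆))(ℂ) → Sh_K(U(H))(ℂ)`, `[v, uK⋆] ↦ [𝔹(B^τ(v ⊕ 0)), φGS(u)K]`.

RESULTS.
* §1 `ShimuraSetGS.continuous_embPoints` — the embedding on complex points is continuous for the quotient topologies
  (`ShimuraSetGS.isQuotientMap_mk`: `(v, u) ↦ [v, uK⋆]` is a quotient map; the dehomogenisation chart ★ `negConeBallCoord` is
  continuous on the negative cone, ★ `continuous_φGS`, ★ `continuous_frameEmbNeg` of `UnitaryShimuraCurveEmbeddingWitnessFinite`).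
* §2 `RecordSystem.smul_ptsSymm_embPoints_mk` — GALOIS MOVES THE EMBEDDED HECKE ORBIT OF A CURVE CM POINT INSIDE ITSELF:
  `σ • pts_K⁻¹(embPoints [τw, uK⋆]) = pts_K⁻¹(embPoints [τw, d⋆·uK⋆])` for `σ ∈ Aut(ℂ/τL)` with Artin correspondent `s` and a curve
  twist `d⋆` of `w` (★ `IsDiagTwistGS … (recipFactor L s) d⋆`) — the SURFACE record's reciprocity field ★ `RecordSystem.recip`
  (quantified over all diagonal twists) at the line point of `v₃ = B·(w ⊕ 0)`, fed with the transported twist `φGS(d⋆)` (★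
  `isDiagTwist_φGS_of_isDiagTwistGS`) and ★ `embPoints_mk_of_isLinePoint`.
* §3 `RecordSystem.gal_image_closure_embPoints_subset` — **R2-3′, IMAGE STABILITY**: every `σ ∈ Aut(ℂ/τL)`, acting on `(M_K)_τ`
  through ★ `GaloisDescent.gal`, maps the ZARISKI CLOSURE `C` of the underlying points of the embedded curve into itself.  Deligne's
  density argument ([Deligne1971TravauxShimura] 5.2, Cor. 5.7; [Milne2005ShimuraVarieties] Lemma 13.5, Thm. 13.6), i.e. the cell's ★ T3
  S5 composition `ExtReceptacle.imageStable_of_leaves` with the receptacle replaced by the identity: §2 + ★ `Motives.pt_baseChangeEquiv_smul`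
  + density of one Hecke orbit in the curve (★ `ShimuraSetGS.dense_heckeOrbit`) carried by §1 and the record's normalisation
  homeomorphism (★ `RecordSystem.exists_homeomorph_complexFibre`) + ★ `ComplexPoints.continuous_pt` + closures.  No scheme structure
  on the image, no injectivity of `embPoints`, no torsion-freeness of levels is used; the empty-cone case is vacuous.
* §4 `RecordSystem.gal_image_range_subset_of_range_eq_closure_embPoints` — §3 in closed-immersion currency (`gal σ '' range ι ⊆ range ι`
  for any `ι : Y ⟶ (M_K)_τ` with `range ι = C`: the `hst` hypothesis of ★ `Motives.exists_subtower_of_stable`, levelwise);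
  `RecordSystem.exists_iso_baseChange_of_range_eq_closure_embPoints` — **R2-4, CLOSURE DESCENT (one level)**: every REDUCED closed
  subscheme of `(M_K)_τ` with underlying set `C` is, over `(M_K)_τ`, the base change of a closed `L`-subscheme `Z ↪ M_K` (§3 fed to ★
  `GaloisDescent.exists_iso_bcFunctor_map_eq_of_isReduced_of_image_subset_complex`; `L` is countable); and
  `RecordSystem.exists_closedSubscheme_baseChange_range_eq_closure_embPoints` — applied to the reduced induced structure on `C`
  (Mathlib `Scheme.IdealSheafData.vanishingIdeal`): a closed `L`-subscheme `j : Z ↪ M_K` with `Z_ℂ` reduced and `|Z_ℂ| = C` exactly —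
  the candidate `L`-model of the curve at level `K⋆` INSIDE the surface.

What is NOT here (later leaves of road (ii)): injectivity of `embPoints` at small trace levels ([Deligne1971TravauxShimura] Prop. 1.15;
census R2-1-inj), the identification of the closed points of `C` with the embedded curve and smoothness at injective level (R2-2, special
cycles), the tower/transition clause and the record fields of `Z` (R2-5), and any existence statement for the surface record (u0 ⇐ #62).

## References
* [Deligne1971TravauxShimura] P. Deligne, *Travaux de Shimura*, Sém. Bourbaki 389 (1971): Prop. 1.15 p. 132, 5.2 p. 155, Cor. 5.7 p. 156, Variante 5.9 p. 157.
* [Milne2005ShimuraVarieties] J. S. Milne, *Introduction to Shimura varieties* (2005/2017): Lemma 5.13 p. 57, Def. 12.5 p. 113, (60)–(62) p. 114,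
  Prop. 13.1 p. 117, Lemma 13.5 – Thm. 13.6 p. 118, Thm. 13.7 – Rem. 13.8 p. 119.
* [Deligne1979ShimuraVarieties] P. Deligne, *Variétés de Shimura* (1979), 2.2.4–2.2.6.
* [Liu2021] Y. Liu, *Fourier–Jacobi cycles and arithmetic relative trace formula*, Camb. J. Math. 9 (2021), proof of Thm. 4.15 (FJcycle.tex l. 2193–2208).
* [Margulis1991] G. A. Margulis, *Discrete subgroups of semisimple Lie groups* (1991), Ch. I (0.11) p. 17 (`k`-closed = defined over `k`).
* [Hartshorne1977] R. Hartshorne, *Algebraic Geometry*, II Example 3.2.6 and Ex. 3.11 (d) (reduced induced closed subscheme).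
-/

noncomputable section

open Function MulAction Topology NumberField IsDedekindDomain CategoryTheory Matrix AlgebraicGeometry
open scoped Matrix ComplexOrder
open Literature.AlgebraicGeometry.Motives Literature.NumberTheory.Automorphic Literature.NumberTheory.Automorphic.UnitaryGroup
open Literature.NumberTheory.Automorphic.ShimuraDissection
open Literature.NumberTheory.Automorphic.Liu2021.AppendixC (C5.OpenCompactSubgroup C5.SmallLevel)
open Literature.Geometry.ComplexHyperbolic Literature.Geometry.ComplexHyperbolic.BallModel

namespace Literature.AlgebraicGeometry.ShimuraVarieties.UnitaryCanonicalModel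

variable {L : Type} [Field L] [NumberField L] [IsCMField L]

/-! ### §R23.1 The embedding on complex points is continuous -/

section Continuity

variable (L) (H : Matrix (Fin 3) (Fin 3) L) (τ : L →+* ℂ) (T : GL (Fin 3) ℂ)
  (hT : formCongr (starRingEnd ℂ) T (H.map τ) = BallModel.J)
  (Jstar : Matrix (Fin 2) (Fin 2) L) (Jperp : Matrix (Fin 1) (Fin 1) L) (B : GL (Fin 3) L) {a : L} (ha : a ≠ 0)
  (hB : formCongr ((IsCMField.complexConj L : L ≃ₐ[↥(maximalRealSubfield L)] L) : L →+* L) B (a • H) =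
    finSum 2 1 Jstar Jperp)
  (hτa : 0 < (τ a).re) (hτa' : (τ a).im = 0)
  (Kstar : Subgroup ↥(finAdelic (↥(maximalRealSubfield L)) L (IsCMField.complexConj L) 2 Jstar))
  (K : Subgroup ↥(finAdelic (↥(maximalRealSubfield L)) L (IsCMField.complexConj L) 3 H))
  (hK : Kstar.map (φGS L Jstar Jperp H B ha hB) ≤ K)

/-- **The class map `(v, u) ↦ [v, uK⋆]` of the curve's Shimura set is a quotient map** (`negCone(J⋆^τ) × U(J⋆)(𝔸_f) →
`Sh_{K⋆}(ℂ)`: the coset projection is an open quotient map, then the orbit quotient). [cite: Milne2005ShimuraVarieties, Lemma 5.13 p. 57] -/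
theorem ShimuraSetGS.isQuotientMap_mk :
    IsQuotientMap fun p : ↥(negCone (Jstar.map τ)) × ↥(finAdelic (↥(maximalRealSubfield L)) L (IsCMField.complexConj L) 2 Jstar) =>
      ShimuraSetGS.mk L Jstar τ Kstar (p.1 : Fin 2 → ℂ) p.1.2 p.2 := by
  have h1 : IsOpenQuotientMap (Prod.map (id : ↥(negCone (Jstar.map τ)) → ↥(negCone (Jstar.map τ)))
      (QuotientGroup.mk : ↥(finAdelic (↥(maximalRealSubfield L)) L (IsCMField.complexConj L) 2 Jstar) →
        ↥(finAdelic (↥(maximalRealSubfield L)) L (IsCMField.complexConj L) 2 Jstar) ⧸ Kstar)) :=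
    IsOpenQuotientMap.id.prodMap (QuotientGroup.isOpenQuotientMap_mk (N := Kstar))
  exact isQuotientMap_quotient_mk'.comp h1.isQuotientMap

/-- **The embedding `Sh_{K⋆}(U(J⋆))(ℂ) → Sh_K(U(H))(ℂ)`, `[v, uK⋆] ↦ [𝔹(B^τ(v ⊕ 0)), φGS(u)K]`, is continuous** (quotient
topologies on both sides): the dehomogenisation chart is continuous on the negative cone (★ `differentiableOn_negConeBallCoord`),
`φGS` is continuous (★ `continuous_φGS`). [cite: Milne2005ShimuraVarieties, Lemma 5.13 p. 57, Thm. 13.6 p. 118] -/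
theorem ShimuraSetGS.continuous_embPoints :
    Continuous (ShimuraSetGS.embPoints L H τ T hT Jstar Jperp B ha hB hτa hτa' Kstar K hK) := by
  refine (ShimuraSetGS.isQuotientMap_mk L τ Jstar Kstar).continuous_iff.2 ?_
  -- on representatives the map is `(v, u) ↦ [𝔹(B^τ(v ⊕ 0)), φGS(u)K]`
  have hfun : (ShimuraSetGS.embPoints L H τ T hT Jstar Jperp B ha hB hτa hτa' Kstar K hK ∘ fun p :
      ↥(negCone (Jstar.map τ)) × ↥(finAdelic (↥(maximalRealSubfield L)) L (IsCMField.complexConj L) 2 Jstar) =>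
        ShimuraSetGS.mk L Jstar τ Kstar (p.1 : Fin 2 → ℂ) p.1.2 p.2) =
      fun p => ShimuraSet.mk L H τ T hT K (negConeToBall hT (frameEmbNeg_mem_negCone τ hB hτa hτa' p.1.2))
        (φGS L Jstar Jperp H B ha hB p.2) := by
    funext p
    exact ShimuraSetGS.embPoints_mk L H τ T hT Jstar Jperp B ha hB hτa hτa' Kstar K hK _ p.1.2 p.2
  rw [hfun]
  -- the ball coordinate is continuous on the cone
  have hball : Continuous fun p :
      ↥(negCone (Jstar.map τ)) × ↥(finAdelic (↥(maximalRealSubfield L)) L (IsCMField.complexConj L) 2 Jstar) =>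
        ((negConeToBall hT (frameEmbNeg_mem_negCone τ hB hτa hτa' p.1.2) : Ball).1) := by
    have hval : (fun p :
        ↥(negCone (Jstar.map τ)) × ↥(finAdelic (↥(maximalRealSubfield L)) L (IsCMField.complexConj L) 2 Jstar) =>
          ((negConeToBall hT (frameEmbNeg_mem_negCone τ hB hτa hτa' p.1.2) : Ball).1)) =
        fun p => negConeBallCoord T (frameEmbNeg τ B (p.1 : Fin 2 → ℂ)) := by
      funext p
      exact negConeToBall_val hT _
    rw [hval]
    have hc : Continuous fun p :
        ↥(negCone (Jstar.map τ)) × ↥(finAdelic (↥(maximalRealSubfield L)) L (IsCMField.complexConj L) 2 Jstar) =>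
          frameEmbNeg τ B (p.1 : Fin 2 → ℂ) :=
      (continuous_frameEmbNeg L τ B).comp (continuous_subtype_val.comp continuous_fst)
    exact (differentiableOn_negConeBallCoord hT).continuousOn.comp_continuous hc
      fun p => frameEmbNeg_mem_negCone τ hB hτa hτa' p.1.2
  have hz : Continuous fun p :
      ↥(negCone (Jstar.map τ)) × ↥(finAdelic (↥(maximalRealSubfield L)) L (IsCMField.complexConj L) 2 Jstar) =>
        (negConeToBall hT (frameEmbNeg_mem_negCone τ hB hτa hτa' p.1.2) : Ball) :=
    Continuous.subtype_mk hball _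
  have hu : Continuous fun p :
      ↥(negCone (Jstar.map τ)) × ↥(finAdelic (↥(maximalRealSubfield L)) L (IsCMField.complexConj L) 2 Jstar) =>
        (QuotientGroup.mk (φGS L Jstar Jperp H B ha hB p.2) :
          finAdelic (↥(maximalRealSubfield L)) L (IsCMField.complexConj L) 3 H ⧸ K) :=
    continuous_quotient_mk'.comp ((continuous_φGS L Jstar Jperp H B ha hB).comp continuous_snd)
  unfold ShimuraSet.mk
  exact continuous_quotient_mk'.comp (hz.prodMk hu)

end Continuity

/-! ### §R23.2 Reciprocity on the embedded Hecke orbit of a curve CM point -/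

section Orbit

variable {Jstar : Matrix (Fin 2) (Fin 2) L} {τ : L →+* ℂ}
  {H : Matrix (Fin 3) (Fin 3) L} {T : GL (Fin 3) ℂ} {hT : formCongr (starRingEnd ℂ) T (H.map τ) = BallModel.J}
  {K₀' : C5.OpenCompactSubgroup ↥(finAdelic (↥(maximalRealSubfield L)) L (IsCMField.complexConj L) 3 H)}
  (R : RecordSystem L H τ T hT K₀')
  (Jperp : Matrix (Fin 1) (Fin 1) L) (B : GL (Fin 3) L) {a : L} (ha : a ≠ 0)
  (hB : formCongr ((IsCMField.complexConj L : L ≃ₐ[↥(maximalRealSubfield L)] L) : L →+* L) B (a • H) = finSum 2 1 Jstar Jperp)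
  (hτa : 0 < (τ a).re) (hτa' : (τ a).im = 0)
  (Kstar : Subgroup ↥(finAdelic (↥(maximalRealSubfield L)) L (IsCMField.complexConj L) 2 Jstar))
  (K : C5.SmallLevel K₀') (hK : Kstar.map (φGS L Jstar Jperp H B ha hB) ≤ K.1.1)

set_option maxHeartbeats 400000 in -- instance-heavy adelic / Shimura-set statement: `whnf`/`isDefEq` time out at the default (as ★ `UnitaryShimuraCurveEmbeddingDescent` §2)
/-- **Galois moves the embedded Hecke orbit of a curve CM point inside itself**: for `σ ∈ Aut(ℂ/τL)` with Artin correspondent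
`s`, an `L`-rational negative `w ∈ L²` and a curve twist `d⋆` of eigenvalue `c(s)/s` on `w` (★ `IsDiagTwistGS`),
`σ • pts⁻¹(embPoints [τw, uK⋆]) = pts⁻¹(embPoints [τw, d⋆·uK⋆])` in the SURFACE model `M_K(U(H))` — the rank-3 record's
reciprocity field (★ `RecordSystem.recip`, quantified over all diagonal twists) at the line point of `v₃ = B·(w ⊕ 0)` fed with the
TRANSPORTED twist `φGS(d⋆)` (`isDiagTwist_φGS_of_isDiagTwistGS`), and `embPoints [τw, uK⋆] = [x₀, φGS(u)K]`
(`embPoints_mk_of_isLinePoint`). [cite: Milne2005ShimuraVarieties, (62) p. 114, Rem. 13.8 p. 119] [cite: Deligne1979ShimuraVarieties, 2.2.4–2.2.6] -/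
theorem RecordSystem.smul_ptsSymm_embPoints_mk (σ : letI : Algebra L ℂ := τ.toAlgebra; ℂ ≃ₐ[L] ℂ)
    {s : (FiniteAdeleRing (𝓞 L) L)ˣ} (hs : letI : Algebra L ℂ := τ.toAlgebra; IsArtinCorrespondent L τ s σ.toRingEquiv)
    {w : Fin 2 → L} (hw : (fun i => τ (w i)) ∈ negCone (Jstar.map τ))
    {dstar : ↥(finAdelic (↥(maximalRealSubfield L)) L (IsCMField.complexConj L) 2 Jstar)}
    (hd : IsDiagTwistGS L Jstar w (recipFactor L s) dstar)
    (u : ↥(finAdelic (↥(maximalRealSubfield L)) L (IsCMField.complexConj L) 2 Jstar)) :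
    letI : Algebra L ℂ := τ.toAlgebra
    σ • (R.pts K).symm (ShimuraSetGS.embPoints L H τ T hT Jstar Jperp B ha hB hτa hτa' Kstar K.1.1 hK
        (ShimuraSetGS.mk L Jstar τ Kstar (fun i => τ (w i)) hw u)) =
      (R.pts K).symm (ShimuraSetGS.embPoints L H τ T hT Jstar Jperp B ha hB hτa hτa' Kstar K.1.1 hK
        (ShimuraSetGS.mk L Jstar τ Kstar (fun i => τ (w i)) hw (dstar * u))) := by
  letI : Algebra L ℂ := τ.toAlgebra
  -- the image CM point: the line point `x₀` of `v₃ = B·(w ⊕ 0)`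
  obtain ⟨x₀, hx₀, -⟩ := exists_unique_isLinePoint L H τ T hT _ (embedding_frame_append_mem_negCone hB hτa hτa' hw)
  rw [embPoints_mk_of_isLinePoint ha hB hτa hτa' Kstar K.1.1 hK hw hx₀ u,
    embPoints_mk_of_isLinePoint ha hB hτa hτa' Kstar K.1.1 hK hw hx₀ (dstar * u), map_mul]
  exact R.recip K σ s hs _ x₀ hx₀ _ (isDiagTwist_φGS_of_isDiagTwistGS L Jstar Jperp H B ha hB hd) _

end Orbit

/-! ### §R23.3 Image stability: `Aut(ℂ/τL)` maps the Zariski closure of the embedded curve into itself -/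

section ImageStable

variable {Jstar : Matrix (Fin 2) (Fin 2) L} {τ : L →+* ℂ}
  {H : Matrix (Fin 3) (Fin 3) L} {T : GL (Fin 3) ℂ} {hT : formCongr (starRingEnd ℂ) T (H.map τ) = BallModel.J}
  {K₀' : C5.OpenCompactSubgroup ↥(finAdelic (↥(maximalRealSubfield L)) L (IsCMField.complexConj L) 3 H)}
  (R : RecordSystem L H τ T hT K₀')
  (Jperp : Matrix (Fin 1) (Fin 1) L) (B : GL (Fin 3) L) {a : L} (ha : a ≠ 0)
  (hB : formCongr ((IsCMField.complexConj L : L ≃ₐ[↥(maximalRealSubfield L)] L) : L →+* L) B (a • H) = finSum 2 1 Jstar Jperp)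
  (hτa : 0 < (τ a).re) (hτa' : (τ a).im = 0)
  (Kstar : Subgroup ↥(finAdelic (↥(maximalRealSubfield L)) L (IsCMField.complexConj L) 2 Jstar))
  (K : C5.SmallLevel K₀') (hK : Kstar.map (φGS L Jstar Jperp H B ha hB) ≤ K.1.1)

/-- The record's normalisation homeomorphism `e : (M_K)_τ(ℂ) ≃ₜ Sh_K(ℂ)` satisfies `e⁻¹ Q = baseChangeEquiv τ M_K (pts_K⁻¹ Q)`
for EVERY point `Q` (★ `RecordSystem.exists_homeomorph_complexFibre` states it on classes `[z, aK]`; every point is one).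
[cite: ConradAdelicPoints2012, Prop. 2.1] -/
theorem RecordSystem.exists_homeomorph_complexFibre_apply (K : C5.SmallLevel K₀') :
    ∃ e : ComplexPoints ((Motives.baseChangeHom τ).obj (R.M.obj K)) ≃ₜ ShimuraSet L H τ T hT K.1.1,
      ∀ Q : ShimuraSet L H τ T hT K.1.1,
        e.symm Q = (letI : Algebra L ℂ := τ.toAlgebra
          AlgPoints.baseChangeEquiv τ (R.M.obj K) ((R.pts K).symm Q)) := by
  obtain ⟨e, he⟩ := R.exists_homeomorph_complexFibre K
  refine ⟨e, fun Q => ?_⟩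
  obtain ⟨⟨z, b⟩, rfl⟩ := ShimuraSet.mk_surjective L H τ T hT K.1.1 Q
  exact he z b

set_option maxHeartbeats 400000 in -- instance-heavy adelic / Shimura-set statement: `whnf`/`isDefEq` time out at the default (as ★ `UnitaryShimuraCurveEmbeddingDescent` §2)
/-- **R2-3′ — IMAGE STABILITY of the embedded unitary Shimura curve** ([Deligne 1971] 5.2 / Cor. 5.7 for the sub-datum
`(U(J⋆), 𝔻) ↪ (U(H), 𝔹²)`): for the canonical model `M_K` of the compact unitary Shimura SURFACE (a ★ `RecordSystem`), a frame
`ᵗ(cB)·(a·H)·B = J⋆ ⊕ J⊥` (`τa` a positive real), `J⋆` non-degenerate `c`-hermitian, and ANY subgroup `K⋆ ≤ U(J⋆)(𝔸_f)` with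
`φGS(K⋆) ≤ K`: every `σ ∈ Aut(ℂ/τL)` (acting on `(M_K)_τ` through ★ `GaloisDescent.gal`) maps the ZARISKI CLOSURE `C` of the
underlying points of the embedded curve `{baseChangeEquiv τ (pts_K⁻¹ (embPoints P)) : P ∈ Sh_{K⋆}(U(J⋆))(ℂ)}` into itself.
Proof = Deligne's density argument (★ T3 S5 `imageStable_of_leaves` with the receptacle the identity): reciprocity moves the
embedded Hecke orbit of ONE curve CM point inside itself (`RecordSystem.smul_ptsSymm_embPoints_mk`), `σ` acts on underlying
points through the continuous `gal σ` (★ `Motives.pt_baseChangeEquiv_smul`), that orbit is dense (★ `ShimuraSetGS.dense_heckeOrbit`,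
`ShimuraSetGS.continuous_embPoints`, ★ `RecordSystem.exists_homeomorph_complexFibre`, ★ `ComplexPoints.continuous_pt`), closures.
NO scheme structure on the image, NO injectivity of `embPoints`, NO torsion-freeness is used.
[cite: Deligne1971TravauxShimura, 5.2 p. 155, Cor. 5.7 p. 156] [cite: Milne2005ShimuraVarieties, Lemma 13.5, Thm. 13.6 p. 118, Rem. 13.8 p. 119]
[cite: Liu2021, Thm. 4.15 proof (FJcycle.tex l. 2193–2208)] -/
theorem RecordSystem.gal_image_closure_embPoints_subset (hJ : (Jstar.map (IsCMField.complexConj L))ᵀ = Jstar)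
    (hdet : IsUnit Jstar.det) (σ : letI : Algebra L ℂ := τ.toAlgebra; ℂ ≃ₐ[L] ℂ) :
    letI : Algebra L ℂ := τ.toAlgebra
    ⇑(GaloisDescent.gal ℂ (R.M.obj K) σ) ''
        closure (AlgPoints.pt '' Set.range fun P : ShimuraSetGS L Jstar τ Kstar =>
          AlgPoints.baseChangeEquiv τ (R.M.obj K) ((R.pts K).symm
            (ShimuraSetGS.embPoints L H τ T hT Jstar Jperp B ha hB hτa hτa' Kstar K.1.1 hK P))) ⊆
      closure (AlgPoints.pt '' Set.range fun P : ShimuraSetGS L Jstar τ Kstar =>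
          AlgPoints.baseChangeEquiv τ (R.M.obj K) ((R.pts K).symm
            (ShimuraSetGS.embPoints L H τ T hT Jstar Jperp B ha hB hτa hτa' Kstar K.1.1 hK P))) := by
  letI : Algebra L ℂ := τ.toAlgebra
  set emb : ShimuraSetGS L Jstar τ Kstar → ComplexPoints ((Motives.baseChangeHom τ).obj (R.M.obj K)) :=
    fun P => AlgPoints.baseChangeEquiv τ (R.M.obj K) ((R.pts K).symm
      (ShimuraSetGS.embPoints L H τ T hT Jstar Jperp B ha hB hτa hτa' Kstar K.1.1 hK P)) with hemb_def
  set g : ↥(GaloisDescent.bc ℂ (R.M.obj K)) → ↥(GaloisDescent.bc ℂ (R.M.obj K)) :=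
    fun y => GaloisDescent.gal ℂ (R.M.obj K) σ y with hg_def
  have hg : Continuous g := (GaloisDescent.gal ℂ (R.M.obj K) σ).continuous
  -- `emb` is continuous: `emb = e⁻¹ ∘ embPoints` for the record's normalisation homeomorphism `e`
  have hemb : Continuous emb := by
    obtain ⟨e, he⟩ := R.exists_homeomorph_complexFibre_apply K
    have : emb = fun P => e.symm (ShimuraSetGS.embPoints L H τ T hT Jstar Jperp B ha hB hτa hτa' Kstar K.1.1 hK P) := by
      funext P; rw [he]
    rw [this]
    exact e.symm.continuous.comp
      (ShimuraSetGS.continuous_embPoints L H τ T hT Jstar Jperp B ha hB hτa hτa' Kstar K.1.1 hK)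
  -- CASE SPLIT on the negative cone of `J⋆^τ`
  by_cases hne : (negCone (Jstar.map τ)).Nonempty
  swap
  · -- empty cone: the curve has no complex point, `C = ∅`
    have hempty : IsEmpty (ShimuraSetGS L Jstar τ Kstar) := by
      refine ⟨fun P => hne ?_⟩
      obtain ⟨v, hv, -, -⟩ := ShimuraSetGS.mk_surjective L Jstar τ Kstar P
      exact ⟨v, hv⟩
    haveI := hempty
    rw [Set.range_eq_empty emb, Set.image_empty, closure_empty, Set.image_empty]
  -- a curve CM point `[τw]`, `w ∈ L²` negative at `τ`, Artin correspondent and twist for `σ`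
  obtain ⟨v, hv⟩ := hne
  obtain ⟨w, hw⟩ := exists_embedding_mem_negCone Jstar τ hv
  have hww : hermForm (cmConjRingHom L) Jstar w w ≠ 0 := hermForm_self_ne_zero_of_embedding_mem_negCone hw
  obtain ⟨s, hs⟩ := exists_finiteIdele_isArtinCorrespondent_algEquiv L τ σ
  obtain ⟨dstar, hd⟩ := exists_isDiagTwistGS_recipFactor' L Jstar hJ hww s
  -- (1)+(2): `g` maps the underlying points of the embedded orbit into themselves
  set Sp : Set (ShimuraSetGS L Jstar τ Kstar) :=
    Set.range fun u : ↥(finAdelic (↥(maximalRealSubfield L)) L (IsCMField.complexConj L) 2 Jstar) =>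
      ShimuraSetGS.mk L Jstar τ Kstar (fun i => τ (w i)) hw u with hSp_def
  have h2 : g '' (AlgPoints.pt '' (emb '' Sp)) ⊆ AlgPoints.pt '' (emb '' Sp) := by
    rintro _ ⟨_, ⟨_, ⟨_, ⟨u, rfl⟩, rfl⟩, rfl⟩, rfl⟩
    refine ⟨emb (ShimuraSetGS.mk L Jstar τ Kstar (fun i => τ (w i)) hw (dstar * u)),
      ⟨_, ⟨dstar * u, rfl⟩, rfl⟩, ?_⟩
    have e1 := pt_baseChangeEquiv_smul τ (R.M.obj K) σ ((R.pts K).symm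
      (ShimuraSetGS.embPoints L H τ T hT Jstar Jperp B ha hB hτa hτa' Kstar K.1.1 hK
        (ShimuraSetGS.mk L Jstar τ Kstar (fun i => τ (w i)) hw u)))
    rw [R.smul_ptsSymm_embPoints_mk Jperp B ha hB hτa hτa' Kstar K hK σ hs hw hd u] at e1
    exact e1
  -- (3): the orbit is dense in the curve, hence its embedded underlying points are Zariski dense in `C`
  have hSp : Dense Sp := ShimuraSetGS.dense_heckeOrbit L Jstar τ Kstar hJ hdet hw
  have h3 : AlgPoints.pt '' Set.range emb ⊆ closure (AlgPoints.pt '' (emb '' Sp)) := by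
    have h3a : Set.range emb ⊆ closure (emb '' Sp) := by
      rintro _ ⟨P, rfl⟩
      have hP : P ∈ closure Sp := by rw [hSp.closure_eq]; exact Set.mem_univ P
      exact image_closure_subset_closure_image hemb ⟨P, hP, rfl⟩
    exact (Set.image_mono h3a).trans (image_closure_subset_closure_image ComplexPoints.continuous_pt)
  have hsub : AlgPoints.pt '' (emb '' Sp) ⊆ AlgPoints.pt '' Set.range emb :=
    Set.image_mono (Set.image_subset_range _ _)
  -- (4): closures
  have k1 : g '' (AlgPoints.pt '' Set.range emb) ⊆ closure (AlgPoints.pt '' (emb '' Sp)) :=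
    (Set.image_mono h3).trans ((image_closure_subset_closure_image hg).trans (closure_mono h2))
  have key : g '' closure (AlgPoints.pt '' Set.range emb) ⊆ closure (AlgPoints.pt '' Set.range emb) := by
    refine (image_closure_subset_closure_image hg).trans ?_
    refine (closure_mono k1).trans ?_
    rw [closure_closure]
    exact closure_mono hsub
  exact key

end ImageStable

/-! ### §R23.4 Closure descent: the closure of the embedded curve is (the complexification of) an `L`-closed subscheme -/

section Descent

variable {Jstar : Matrix (Fin 2) (Fin 2) L} {τ : L →+* ℂ}
  {H : Matrix (Fin 3) (Fin 3) L} {T : GL (Fin 3) ℂ} {hT : formCongr (starRingEnd ℂ) T (H.map τ) = BallModel.J}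
  {K₀' : C5.OpenCompactSubgroup ↥(finAdelic (↥(maximalRealSubfield L)) L (IsCMField.complexConj L) 3 H)}
  (R : RecordSystem L H τ T hT K₀')
  (Jperp : Matrix (Fin 1) (Fin 1) L) (B : GL (Fin 3) L) {a : L} (ha : a ≠ 0)
  (hB : formCongr ((IsCMField.complexConj L : L ≃ₐ[↥(maximalRealSubfield L)] L) : L →+* L) B (a • H) = finSum 2 1 Jstar Jperp)
  (hτa : 0 < (τ a).re) (hτa' : (τ a).im = 0)
  (Kstar : Subgroup ↥(finAdelic (↥(maximalRealSubfield L)) L (IsCMField.complexConj L) 2 Jstar))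
  (K : C5.SmallLevel K₀') (hK : Kstar.map (φGS L Jstar Jperp H B ha hB) ≤ K.1.1)

set_option maxHeartbeats 400000 in -- instance-heavy adelic / Shimura-set statement: `whnf`/`isDefEq` time out at the default (as ★ `UnitaryShimuraCurveEmbeddingDescent` §2)
/-- **Stability in closed-immersion currency** (the hypothesis `hst` of ★ `GaloisDescent.exists_iso_bcFunctor_map_eq_of_isReduced_of_image_subset_complex`
and of ★ `Motives.exists_subtower_of_stable`, discharged): for ANY morphism `ι : Y ⟶ (M_K)_τ` whose underlying image is the Zariski closure `C`
of the embedded curve, `gal σ` maps `range ι` into itself.  (The three carrier spellings `GaloisDescent.bc ℂ M_K`, `((bcFunctor L ℂ).obj M_K).left`,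
`((baseChangeHom τ).obj M_K).left` are definitionally equal; the proof is pointwise so that no motive is rewritten across them.)
[cite: Deligne1971TravauxShimura, 5.2 p. 155, Cor. 5.7 p. 156] [cite: Margulis1991, Ch. I (0.11) p. 17] -/
theorem RecordSystem.gal_image_range_subset_of_range_eq_closure_embPoints (hJ : (Jstar.map (IsCMField.complexConj L))ᵀ = Jstar)
    (hdet : IsUnit Jstar.det) {Y : SchemeOver ℂ}
    (ι : letI : Algebra L ℂ := τ.toAlgebra; Y ⟶ (AbelianVariety.bcFunctor L ℂ).obj (R.M.obj K))
    (hι : letI : Algebra L ℂ := τ.toAlgebra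
      Set.range ⇑ι.left = closure (AlgPoints.pt '' Set.range fun P : ShimuraSetGS L Jstar τ Kstar =>
          AlgPoints.baseChangeEquiv τ (R.M.obj K) ((R.pts K).symm
            (ShimuraSetGS.embPoints L H τ T hT Jstar Jperp B ha hB hτa hτa' Kstar K.1.1 hK P))))
    (σ : letI : Algebra L ℂ := τ.toAlgebra; ℂ ≃ₐ[L] ℂ) :
    letI : Algebra L ℂ := τ.toAlgebra
    ⇑(GaloisDescent.gal ℂ (R.M.obj K) σ) '' Set.range ⇑ι.left ⊆ Set.range ⇑ι.left := by
  letI : Algebra L ℂ := τ.toAlgebra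
  have hC := R.gal_image_closure_embPoints_subset Jperp B ha hB hτa hτa' Kstar K hK hJ hdet σ
  intro y hy
  obtain ⟨x, hx, rfl⟩ := hy
  exact hι.symm.subset (hC ⟨x, hι.subset hx, rfl⟩)

set_option maxHeartbeats 400000 in -- instance-heavy adelic / Shimura-set statement: `whnf`/`isDefEq` time out at the default (as ★ `UnitaryShimuraCurveEmbeddingDescent` §2)
/-- **R2-4 (one level) — CLOSURE DESCENT** ([Deligne 1971] Cor. 5.7 «le sous-schéma … est défini sur `E`», for the embedded curve):
every REDUCED closed subscheme `ι : Y ↪ (M_K)_τ` of the complexified surface model whose underlying set is the Zariski closure `C`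
of the embedded curve `Sh_{K⋆}(U(J⋆))(ℂ)` is — up to an isomorphism over `(M_K)_τ` — the base change of a closed immersion of
`L`-schemes `Z ↪ M_K`: image stability (`RecordSystem.gal_image_closure_embPoints_subset`) fed to the effective descent of
`Aut(ℂ/L)`-stable reduced closed subschemes ★ `GaloisDescent.exists_iso_bcFunctor_map_eq_of_isReduced_of_image_subset_complex`
(`L` is countable).  `Z` is the candidate `L`-model of the curve at level `K⋆` inside the surface (road (ii) of the cell's GS-3 census).
[cite: Deligne1971TravauxShimura, Cor. 5.7 p. 156 (proof), Variante 5.9 p. 157] [cite: Margulis1991, Ch. I (0.11) p. 17]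
[cite: Milne2005ShimuraVarieties, Thm. 13.7 and Rem. 13.8 p. 119] -/
theorem RecordSystem.exists_iso_baseChange_of_range_eq_closure_embPoints (hJ : (Jstar.map (IsCMField.complexConj L))ᵀ = Jstar)
    (hdet : IsUnit Jstar.det) (Y : SchemeOver ℂ)
    (ι : letI : Algebra L ℂ := τ.toAlgebra; Y ⟶ (AbelianVariety.bcFunctor L ℂ).obj (R.M.obj K))
    [IsClosedImmersion ι.left] [IsReduced Y.left]
    (hι : letI : Algebra L ℂ := τ.toAlgebra
      Set.range ⇑ι.left = closure (AlgPoints.pt '' Set.range fun P : ShimuraSetGS L Jstar τ Kstar =>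
          AlgPoints.baseChangeEquiv τ (R.M.obj K) ((R.pts K).symm
            (ShimuraSetGS.embPoints L H τ T hT Jstar Jperp B ha hB hτa hτa' Kstar K.1.1 hK P)))) :
    letI : Algebra L ℂ := τ.toAlgebra
    ∃ (Z : SchemeOver L) (j : Z ⟶ R.M.obj K) (_ : IsClosedImmersion j.left)
      (e : Y ≅ (AbelianVariety.bcFunctor L ℂ).obj Z), e.hom ≫ (AbelianVariety.bcFunctor L ℂ).map j = ι := by
  letI : Algebra L ℂ := τ.toAlgebra
  have hL : Cardinal.mk L ≤ Cardinal.aleph0 := by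
    refine (Algebra.IsAlgebraic.cardinalMk_le_max ℚ L).trans ?_
    rw [Cardinal.mkRat, max_self]
  exact GaloisDescent.exists_iso_bcFunctor_map_eq_of_isReduced_of_image_subset_complex (R.M.obj K) hL ι
    (R.gal_image_range_subset_of_range_eq_closure_embPoints Jperp B ha hB hτa hτa' Kstar K hK hJ hdet ι hι)

set_option maxHeartbeats 400000 in -- instance-heavy adelic / Shimura-set statement: `whnf`/`isDefEq` time out at the default (as ★ `UnitaryShimuraCurveEmbeddingDescent` §2)
/-- **R2-4 — the `L`-MODEL OF THE CLOSURE**: there is a closed `L`-subscheme `j : Z ↪ M_K` of the surface model whose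
complexification `Z_ℂ ↪ (M_K)_τ` is REDUCED with underlying set EXACTLY the Zariski closure `C` of the embedded curve
`Sh_{K⋆}(U(J⋆))(ℂ)` — the previous theorem applied to the reduced induced closed subscheme on `C` (Mathlib
`Scheme.IdealSheafData.vanishingIdeal`/`subschemeι`; reducedness = the in-proof twin of ★
`Resolution.ComponentGluing.isReduced_subscheme_vanishingIdeal`, not imported to keep the resolution cone out).
[cite: Deligne1971TravauxShimura, Cor. 5.7 p. 156 (proof)] [cite: Margulis1991, Ch. I (0.11) p. 17] [cite: Hartshorne1977, II Ex. 3.11 (d) and Example 3.2.6] -/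
theorem RecordSystem.exists_closedSubscheme_baseChange_range_eq_closure_embPoints
    (hJ : (Jstar.map (IsCMField.complexConj L))ᵀ = Jstar) (hdet : IsUnit Jstar.det) :
    letI : Algebra L ℂ := τ.toAlgebra
    ∃ (Z : SchemeOver L) (j : Z ⟶ R.M.obj K) (_ : IsClosedImmersion j.left),
      IsReduced ((AbelianVariety.bcFunctor L ℂ).obj Z).left ∧
        Set.range ⇑((AbelianVariety.bcFunctor L ℂ).map j).left =
          closure (AlgPoints.pt '' Set.range fun P : ShimuraSetGS L Jstar τ Kstar =>
            AlgPoints.baseChangeEquiv τ (R.M.obj K) ((R.pts K).symm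
              (ShimuraSetGS.embPoints L H τ T hT Jstar Jperp B ha hB hτa hτa' Kstar K.1.1 hK P))) := by
  letI : Algebra L ℂ := τ.toAlgebra
  set X : SchemeOver ℂ := (AbelianVariety.bcFunctor L ℂ).obj (R.M.obj K) with hX
  set C : Set ↥X.left := closure (AlgPoints.pt '' Set.range fun P : ShimuraSetGS L Jstar τ Kstar =>
    AlgPoints.baseChangeEquiv τ (R.M.obj K) ((R.pts K).symm
      (ShimuraSetGS.embPoints L H τ T hT Jstar Jperp B ha hB hτa hτa' Kstar K.1.1 hK P))) with hC
  let Cc : TopologicalSpace.Closeds ↥X.left := ⟨C, isClosed_closure⟩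
  let I : X.left.IdealSheafData := Scheme.IdealSheafData.vanishingIdeal Cc
  -- the reduced induced closed subscheme on `C` (in-proof twin of ★ `ComponentGluing.isReduced_subscheme_vanishingIdeal`)
  haveI hred : IsReduced I.subscheme := by
    haveI : ∀ U, IsReduced (I.subschemeCover.openCover.X U) := by
      intro (U : X.left.affineOpens)
      change IsReduced (Spec (.of (Γ(X.left, (U : X.left.Opens)) ⧸ I.ideal U)))
      haveI : _root_.IsReduced (Γ(X.left, (U : X.left.Opens)) ⧸ I.ideal U) := by
        rw [← Ideal.isRadical_iff_quotient_reduced, Scheme.IdealSheafData.vanishingIdeal_ideal]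
        exact PrimeSpectrum.isRadical_vanishingIdeal _
      infer_instance
    exact IsReduced.of_openCover _ I.subschemeCover.openCover
  have hrange : Set.range ⇑I.subschemeι = C := by
    rw [Scheme.IdealSheafData.range_subschemeι, Scheme.IdealSheafData.coe_support_vanishingIdeal]
    rfl
  let Y : SchemeOver ℂ := Over.mk (I.subschemeι ≫ X.hom)
  let ι : Y ⟶ X := Over.homMk I.subschemeι rfl
  haveI : IsClosedImmersion ι.left := by change IsClosedImmersion I.subschemeι; infer_instance
  haveI : IsReduced Y.left := hred
  obtain ⟨Z, j, hj, e, he⟩ := R.exists_iso_baseChange_of_range_eq_closure_embPoints Jperp B ha hB hτa hτa' Kstar K hK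
    hJ hdet Y ι hrange
  refine ⟨Z, j, hj, ?_, ?_⟩
  · -- reducedness transfers along the isomorphism `e : Y ≅ Z_ℂ` (`e⁻¹.left` is an isomorphism, hence an open immersion)
    exact isReduced_of_isOpenImmersion e.inv.left
  · -- `bc j = e⁻¹ ≫ ι` and `e⁻¹.left` is surjective on points
    have hbj : (AbelianVariety.bcFunctor L ℂ).map j = e.inv ≫ ι := by rw [← he, Iso.inv_hom_id_assoc]
    have hfun : (⇑((AbelianVariety.bcFunctor L ℂ).map j).left : _ → ↥X.left) = ⇑ι.left ∘ ⇑e.inv.left := by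
      funext x
      rw [hbj, Over.comp_left]
      exact Scheme.Hom.comp_apply _ _ x
    rw [hfun, (e.inv.left.surjective).range_comp]
    exact hrange

end Descent

end Literature.AlgebraicGeometry.ShimuraVarieties.UnitaryCanonicalModel

end
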